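import Summits.ResolutionOfSingularities.ResolutionOfSingularities.Theses.RuledResidues
import Summits.ResolutionOfSingularities.ResolutionOfSingularities.Theorems.RuledResiduesNonRuledCofiniteStubExceptionalPrimesFinite
import Summits.ResolutionOfSingularities.ResolutionOfSingularities.Theorems.RuledResiduesRegularModelRuled
import Summits.ResolutionOfSingularities.ResolutionOfSingularities.Theorems.NonRuledDivisors.Negative.NoAlgebraicWitness
import Literature.AlgebraicGeometry.Resolution.DivisorialPlace
import Literature.AlgebraicGeometry.Resolution.PrimeDivisors
import Literature.AlgebraicGeometry.Resolution.JacobianRegularLocus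
import Literature.RingTheory.RegularLocalRing.QuotientDVR
import HarnessLib

/-!
# Crux `NonRuledDivisors` (stmt-ResolutionOfSingularities-18075, route `RuledResidues`) —
# a THIRD kill: a finite regular atlas of the FUNCTION FIELD already makes every witness set finite

`NonRuledDivisors` (THE WITNESS of the refutation-shaped route) asks for an affine model `R` of a
function field `K/k` of characteristic `p` with INFINITELY many valuation rings `W ⊇ k, R` of `K`
(DVR, essentially of finite type) centred at NON-regular points of `Spec R` and with residue field
NOT ruled over `k`.  The route's kill `NonRuledCofinite` (stmt-18076) needs a resolution OF THE
MODEL, `Scheme.HasResolution (Spec R)` — a regular scheme proper and birational OVER `Spec R`.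

Negative-side support (lead c2 of the crux, line `contracted-divisor`), sorry-free and
definition-free.  The observation: the proof of `NonRuledCofinite` never uses that the regular
charts contain `R`.  A FINITE REGULAR ATLAS of `K/k` relative to `R` — finitely many finitely
generated REGULAR `k`-subalgebras `B` of `K` with `Frac B = K` such that every valuation ring
`W ≠ K` of `K` containing `k` and `R` contains one of them (this is what ANY regular proper
`k`-model of the function field `K` provides, by the valuative criterion; no morphism to `Spec R`
is asked) — forces the same finiteness:

* `regularAtlas_exceptionalCentre` — on a regular chart `B ⊆ W` (`Frac B = K`), a valuation ring
  `W ≠ K` dominating no regular local ring of dimension `≥ 2` of an affine model is the place of its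
  centre: `W = B_𝔭` elementwise (`R ≤ B` NOT needed; variant of `stub_exceptionalCentre`);
* `regularAtlas_badSet_finite` — `NonRuledCofinite`'s conclusion (finitely many `W ⊇ R` over
  `Sing R` without a good regular model) from a finite regular atlas instead of a resolution: seen
  from the compositum chart `C = R ⊔ B ⊆ W` one has `W = C_𝔓`, `𝔓` a height-one prime of `C` at
  which `C` is regular and `R` is not, and those are finitely many (`stub_exceptionalPrimesFinite`);
* `nonRuledDivisors_witnessSet_finite_of_regularAtlas` — hence (with `RegularModelRuled`,
  stmt-18077) the crux's witness set over EVERY affine model `R` of such a `K` is finite;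
* `nonRuledDivisors_noRegularAtlas` — so a witness `(p, k, K, R)` of `NonRuledDivisors` has a
  function field `K/k` WITHOUT any finite regular atlas: for every finite family of regular affine
  models of `K` some divisorial place of the witness set escapes all of them.  Informally: `K` has
  NO regular proper model whatsoever — the witness function field must itself be a counterexample
  to the WEAK resolution problem ("every function field has a regular projective model"), which
  empties every habitat with `K` rational or `K = k(Y)` for a smooth projective `Y` (e.g. habitat
  (L3) "X rational, badly singular at P" of the line card `Lines/contracted-divisor.md`).

This file does NOT refute the crux.
-/

noncomputable section

set_option linter.dupNamespace false

open IsLocalRing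
open Literature.AlgebraicGeometry.Resolution
open Summit.ResolutionOfSingularities.ResolutionOfSingularities.Theses.RuledResidues

namespace Summit.ResolutionOfSingularities.ResolutionOfSingularities.Theorems

/-! ## One regular chart: the exceptional centre (no `R ≤ B` needed) -/

/-- **An exceptional place on a regular chart is the place of its centre.**  For a finitely
generated regular `k`-subalgebra `B` of `K` with `Frac B = K` inside a valuation ring `W ≠ K` of
`K`: if `W` dominates no regular local ring of dimension `≥ 2` of an affine model `A ⊆ W`, then
the centre `𝔭 = 𝔪_W ∩ B` has height one and `W = B_𝔭 = {a / s | a ∈ B, s ∈ B ∖ 𝔭}` (variant of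
`RuledResiduesNonRuledCofinite.stub_exceptionalCentre` (stmt-18076) with the singular-centre clause replaced by
`W ≠ K`: `ht 𝔭 = 0` would make every non-zero element of `B` a unit of `W`, i.e. `W = K`;
`ht 𝔭 ≥ 2` would make `B` a good model; `ht 𝔭 = 1` makes `B_𝔭` a DVR dominated by `W`).
[folklore] -/
theorem regularAtlas_exceptionalCentre (k K : Type) [Field k] [Field K] [Algebra k K]
    (B : Subalgebra k K) (hB : B.FG) (hBfr : IsFractionRing B K) (hreg : IsRegularRing B)
    (W : ValuationSubring K) (hBW : B.toSubring ≤ W.toSubring) (hW : W ≠ ⊤)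
    (hexc : ¬ ∃ A : Subalgebra k K, A.FG ∧ IsFractionRing A K ∧ ∃ h : A.toSubring ≤ W.toSubring,
      IsRegularLocalRing (Localization.AtPrime
        (Ideal.comap (Subring.inclusion h) (IsLocalRing.maximalIdeal W))) ∧
      (2 : WithBot ℕ∞) ≤ ringKrullDim (Localization.AtPrime
        (Ideal.comap (Subring.inclusion h) (IsLocalRing.maximalIdeal W)))) :
    (centreIdeal B W hBW).height = 1 ∧
      ∀ z : K, z ∈ W ↔ ∃ a s : B, s ∉ centreIdeal B W hBW ∧ z = a / s := by
  haveI := hreg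
  haveI := hBfr
  have hregp : IsRegularLocalRing (Localization.AtPrime (centreIdeal B W hBW)) := inferInstance
  have hdim : ringKrullDim (Localization.AtPrime (centreIdeal B W hBW)) =
      (centreIdeal B W hBW).height :=
    IsLocalization.AtPrime.ringKrullDim_eq_height (centreIdeal B W hBW)
      (Localization.AtPrime (centreIdeal B W hBW))
  have hht : (centreIdeal B W hBW).height = 1 := by
    by_cases h0 : (centreIdeal B W hBW).height = 0
    · exact absurd (Ideal.height_eq_zero_iff_eq_bot.mp h0) (centreIdeal_ne_bot_of_ne_top W B hBW hW)
    by_cases h1 : (centreIdeal B W hBW).height = 1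
    · exact h1
    · exfalso
      have h2 : (2 : ℕ∞) ≤ (centreIdeal B W hBW).height := by
        have h1le : (1 : ℕ∞) ≤ (centreIdeal B W hBW).height := Order.one_le_iff_ne_zero.mpr h0
        have h1lt : (1 : ℕ∞) < (centreIdeal B W hBW).height := lt_of_le_of_ne h1le (Ne.symm h1)
        have h11 : (1 : ℕ∞) + 1 ≤ (centreIdeal B W hBW).height :=
          (ENat.add_one_le_iff ENat.one_ne_top).mpr h1lt
        rwa [one_add_one_eq_two] at h11
      apply hexc
      refine ⟨B, hB, hBfr, hBW, hregp, ?_⟩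
      change (2 : WithBot ℕ∞) ≤ ringKrullDim (Localization.AtPrime (centreIdeal B W hBW))
      rw [hdim]
      have h2' : ((2 : ℕ∞) : WithBot ℕ∞) ≤ (centreIdeal B W hBW).height := WithBot.coe_le_coe.mpr h2
      exact (WithBot.coe_ofNat (α := ℕ∞) 2).ge.trans h2'
  refine ⟨hht, fun z => ?_⟩
  have hdim1 : ringKrullDim (Localization.AtPrime (centreIdeal B W hBW)) = 1 := by
    rw [hdim, hht]
    rfl
  have hD : IsDiscreteValuationRing (Localization.AtPrime (centreIdeal B W hBW)) :=
    Literature.RingTheory.RegularLocalRing.isDiscreteValuationRing_of_ringKrullDim_eq_one hdim1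
  exact mem_iff_exists_eq_div_of_primeDivisor W B hBW hD z

/-! ## Finitely many charts: the bad set is finite -/

/-- **`NonRuledCofinite` from a finite regular atlas of the function field.**  Let `R` be an affine
model of `K/k` (`R` finitely generated, `Frac R = K`) and `𝓑` a finite set of finitely generated
REGULAR `k`-subalgebras `B` of `K` with `Frac B = K` such that every valuation ring `W ≠ K` of `K`
containing `k` and `R` and satisfying a prescribed property `Q` (e.g. `Q W := W` is a DVR, or
`Q := ⊤`) contains some `B ∈ 𝓑`.  Then the valuation rings `W ⊇ R` of `K` with `Q W`, containing
`k`, centred at a non-regular point of `Spec R` and dominating no regular local ring of dimension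
`≥ 2` of an affine model, are finitely many: such a `W` is `≠ K` (the centre of `K` on `R` is `0`,
a regular point), contains a chart `B`, equals `B_𝔭` at a height-one centre
(`regularAtlas_exceptionalCentre`), hence equals `C_𝔓` for the compositum chart `C = R ⊔ B ⊆ W`
at its centre `𝔓`, a height-one prime at which `C` is regular (a DVR) and `R` is not; by
`stub_exceptionalPrimesFinite` each `C` has finitely many such primes.  No morphism from the
charts to `Spec R` (i.e. `R ≤ B`) is required. [folklore] -/
theorem regularAtlas_badSet_finite (k K : Type) [Field k] [Field K] [Algebra k K]
    (R : Subalgebra k K) (hR : R.FG) (hfr : IsFractionRing R K)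
    (Q : ValuationSubring K → Prop) (𝓑 : Set (Subalgebra k K)) (h𝓑fin : 𝓑.Finite)
    (h𝓑 : ∀ B ∈ 𝓑, B.FG ∧ IsFractionRing B K ∧ IsRegularRing B)
    (hcov : ∀ W : ValuationSubring K, Q W → W ≠ ⊤ → (∀ c : k, algebraMap k K c ∈ W) →
      R.toSubring ≤ W.toSubring → ∃ B ∈ 𝓑, B.toSubring ≤ W.toSubring) :
    Set.Finite {W : ValuationSubring K | Q W ∧ (∀ c : k, algebraMap k K c ∈ W) ∧
      (∃ h : R.toSubring ≤ W.toSubring, ¬ IsRegularLocalRing (Localization.AtPrime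
        (Ideal.comap (Subring.inclusion h) (IsLocalRing.maximalIdeal W)))) ∧
      ¬ ∃ A : Subalgebra k K, A.FG ∧ IsFractionRing A K ∧ ∃ h : A.toSubring ≤ W.toSubring,
        IsRegularLocalRing (Localization.AtPrime
          (Ideal.comap (Subring.inclusion h) (IsLocalRing.maximalIdeal W))) ∧
        (2 : WithBot ℕ∞) ≤ ringKrullDim (Localization.AtPrime
          (Ideal.comap (Subring.inclusion h) (IsLocalRing.maximalIdeal W)))} := by
  classical
  haveI := hfr
  -- a bad `W` is not all of `K`: the centre of `K` on `R` is `0` and `R_(0)` is a field (regular)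
  have hneTop : ∀ W : ValuationSubring K, ∀ hRW : R.toSubring ≤ W.toSubring,
      ¬ IsRegularLocalRing (Localization.AtPrime
        (Ideal.comap (Subring.inclusion hRW) (IsLocalRing.maximalIdeal W))) → W ≠ ⊤ := by
    intro W hRW hnreg hWtop
    apply hnreg
    have hbot : Ideal.comap (Subring.inclusion hRW) (IsLocalRing.maximalIdeal W) = (⊥ : Ideal R) := by
      refine (Submodule.eq_bot_iff _).mpr fun x hx => ?_
      have hx' : (x : K) ∈ W.nonunits := (mem_centreIdeal_iff_coe_mem_nonunits R W hRW x).mp hx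
      rcases (ValuationSubring.mem_nonunits_iff_or W).mp hx' with h0 | hinv
      · exact Subtype.ext h0
      · exact absurd (hWtop ▸ ValuationSubring.mem_top ((x : K)⁻¹)) hinv
    have hfield : IsRegularLocalRing (Localization.AtPrime (⊥ : Ideal R)) := by
      let _ : Field (Localization.AtPrime (⊥ : Ideal R)) := IsField.toField <| by
        simp [IsLocalRing.isField_iff_maximalIdeal_eq, ← Localization.AtPrime.map_eq_maximalIdeal]
      infer_instance
    exact isRegularLocalRing_localization_atPrime_congr hbot.symm hfield
  -- the bad places seen from the chart `B`
  let E : Subalgebra k K → Set (ValuationSubring K) := fun B =>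
    {W | (∀ c : k, algebraMap k K c ∈ W) ∧ B.toSubring ≤ W.toSubring ∧
      (∃ h : R.toSubring ≤ W.toSubring, ¬ IsRegularLocalRing (Localization.AtPrime
        (Ideal.comap (Subring.inclusion h) (IsLocalRing.maximalIdeal W)))) ∧
      ¬ ∃ A : Subalgebra k K, A.FG ∧ IsFractionRing A K ∧ ∃ h : A.toSubring ≤ W.toSubring,
        IsRegularLocalRing (Localization.AtPrime
          (Ideal.comap (Subring.inclusion h) (IsLocalRing.maximalIdeal W))) ∧
        (2 : WithBot ℕ∞) ≤ ringKrullDim (Localization.AtPrime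
          (Ideal.comap (Subring.inclusion h) (IsLocalRing.maximalIdeal W)))}
  have hE : ∀ B ∈ 𝓑, (E B).Finite := by
    intro B hB
    obtain ⟨hBfg, hBfr, hBreg⟩ := h𝓑 B hB
    -- the compositum chart `C = R ⊔ B`
    let C : Subalgebra k K := R ⊔ B
    have hRC : R ≤ C := le_sup_left
    have hBC : B ≤ C := le_sup_right
    have hCfg : C.FG := hR.sup hBfg
    -- the places `C_𝔓`, `𝔓` an exceptional height-one prime of `C` relative to `R`
    let P : PrimeSpectrum C → Set (ValuationSubring K) := fun 𝔓 =>
      {W | ∀ z : K, z ∈ W ↔ ∃ a s : C, s ∉ 𝔓.asIdeal ∧ z = a / s}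
    have hT := RuledResiduesNonRuledCofinite.stub_exceptionalPrimesFinite k K R C hRC hR hCfg hfr
    refine Set.Finite.subset (hT.biUnion (t := P) fun 𝔓 _ => ?_) ?_
    · refine Set.Subsingleton.finite ?_
      intro W hW W' hW'
      ext z
      exact (hW z).trans (hW' z).symm
    · rintro W ⟨hk, hBW, ⟨hRW, hnreg⟩, hexc⟩
      have hW : W ≠ ⊤ := hneTop W hRW hnreg
      obtain ⟨hht, hmem⟩ := regularAtlas_exceptionalCentre k K B hBfg hBfr hBreg W hBW hW hexc
      -- `C ⊆ W`
      let W' : Subalgebra k K :=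
        { W.toSubring with
          algebraMap_mem' := hk }
      have hCW' : C ≤ W' := sup_le (fun x hx => hRW hx) (fun x hx => hBW hx)
      have hCW : C.toSubring ≤ W.toSubring := fun x hx => hCW' hx
      -- `W = C_𝔓` elementwise (from `W = B_𝔭`)
      have hlocB : ∀ x : K, x ∈ W → ∃ b s : K, b ∈ B ∧ s ∈ B ∧ s ∉ W.nonunits ∧ x * s = b := by
        intro x hx
        obtain ⟨a, s, hs, rfl⟩ := (hmem x).mp hx
        refine ⟨a, s, a.2, s.2, ?_, ?_⟩
        · exact fun h => hs ((mem_centreIdeal_iff_coe_mem_nonunits B W hBW s).mpr h)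
        · exact div_mul_cancel₀ _ (ne_zero_of_notMem_centreIdeal W B hBW hs)
      have hlocC : ∀ x : K, x ∈ W → ∃ b s : K, b ∈ C ∧ s ∈ C ∧ s ∉ W.nonunits ∧ x * s = b := by
        intro x hx
        obtain ⟨b, s, hb, hs, hsu, hxs⟩ := hlocB x hx
        exact ⟨b, s, hBC hb, hBC hs, hsu, hxs⟩
      -- `W` is the localisation of `B` at `𝔭` (regular, dimension one) and of `C` at `𝔓`
      haveI := hBreg
      have hregW : IsRegularLocalRing W := by
        letI := (Subring.inclusion hBW : B →+* W).toAlgebra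
        haveI : IsLocalization.AtPrime W (centreIdeal B W hBW) :=
          isLocalization_atPrime_of_model W hBW hlocB
        exact IsRegularLocalRing.of_ringEquiv (R := Localization.AtPrime (centreIdeal B W hBW))
          (IsLocalization.algEquiv (centreIdeal B W hBW).primeCompl
            (Localization.AtPrime (centreIdeal B W hBW)) W).toRingEquiv
      have hdimW : ringKrullDim W = 1 := by
        letI := (Subring.inclusion hBW : B →+* W).toAlgebra
        haveI : IsLocalization.AtPrime W (centreIdeal B W hBW) :=
          isLocalization_atPrime_of_model W hBW hlocB
        rw [IsLocalization.AtPrime.ringKrullDim_eq_height (centreIdeal B W hBW) W, hht]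
        rfl
      letI := (Subring.inclusion hCW : C →+* W).toAlgebra
      haveI : IsLocalization.AtPrime W (centreIdeal C W hCW) :=
        isLocalization_atPrime_of_model W hCW hlocC
      let e : Localization.AtPrime (centreIdeal C W hCW) ≃+* W :=
        (IsLocalization.algEquiv (centreIdeal C W hCW).primeCompl
          (Localization.AtPrime (centreIdeal C W hCW)) W).toRingEquiv
      have hreg𝔓 : IsRegularLocalRing (Localization.AtPrime (centreIdeal C W hCW)) :=
        IsRegularLocalRing.of_ringEquiv (R := W) e.symm
      have hht𝔓 : (centreIdeal C W hCW).height = 1 := by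
        have h := IsLocalization.AtPrime.ringKrullDim_eq_height (centreIdeal C W hCW) W
        rw [hdimW] at h
        exact_mod_cast h.symm
      have hcomap : Ideal.comap (Subring.inclusion hRW) (IsLocalRing.maximalIdeal W) =
          (centreIdeal C W hCW).comap (Subalgebra.inclusion hRC).toRingHom := by
        ext x
        simp only [centreIdeal, Ideal.mem_comap]
        exact Iff.rfl
      have hnreg𝔓 : ¬ IsRegularLocalRing (Localization.AtPrime
          ((centreIdeal C W hCW).comap (Subalgebra.inclusion hRC).toRingHom)) :=
        fun h => hnreg (isRegularLocalRing_localization_atPrime_congr hcomap.symm h)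
      refine Set.mem_biUnion (x := (⟨centreIdeal C W hCW, inferInstance⟩ : PrimeSpectrum C))
        ⟨hht𝔓, hreg𝔓, hnreg𝔓⟩ ?_
      -- `W ∈ P 𝔓`
      intro z
      constructor
      · intro hz
        obtain ⟨b, s, hb, hs, hsu, hzs⟩ := hlocC z hz
        refine ⟨⟨b, hb⟩, ⟨s, hs⟩,
          fun h => hsu ((mem_centreIdeal_iff_coe_mem_nonunits C W hCW ⟨s, hs⟩).mp h), ?_⟩
        have hs0 : s ≠ 0 := ne_zero_of_notMem_nonunits W hsu
        change z = b / s
        rw [eq_div_iff hs0, hzs]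
      · rintro ⟨a, s, hs, rfl⟩
        exact div_mem_of_notMem_centreIdeal W C hCW a hs
  refine Set.Finite.subset (h𝓑fin.biUnion hE) ?_
  rintro W ⟨hQ, hk, ⟨hRW, hnr⟩, hexc⟩
  obtain ⟨B, hB, hBW⟩ := hcov W hQ (hneTop W hRW hnr) hk hRW
  exact Set.mem_biUnion hB ⟨hk, hBW, ⟨hRW, hnr⟩, hexc⟩

/-! ## The crux's witness set, and the headline corollary -/

/-- **A finite regular atlas of `K/k` kills the witness over every model.**  Under the atlas
hypothesis of `regularAtlas_badSet_finite` (needed only for discrete valuation rings containing `k`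
and `R`), the witness set of `NonRuledDivisors` over the affine model `R` (verbatim the crux's
set-builder) is finite: its members outside the finite bad set
dominate a regular local ring of dimension `≥ 2` of an affine model, hence have ruled residue
fields by `RegularModelRuled` (stmt-18077, Abhyankar 1956 Prop. 4). [folklore] -/
theorem nonRuledDivisors_witnessSet_finite_of_regularAtlas (k K : Type) [Field k] [Field K]
    [Algebra k K] (R : Subalgebra k K) (hR : R.FG) (hfr : IsFractionRing R K)
    (𝓑 : Set (Subalgebra k K)) (h𝓑fin : 𝓑.Finite)
    (h𝓑 : ∀ B ∈ 𝓑, B.FG ∧ IsFractionRing B K ∧ IsRegularRing B)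
    (hcov : ∀ W : ValuationSubring K, IsDiscreteValuationRing W → (∀ c : k, algebraMap k K c ∈ W) →
      R.toSubring ≤ W.toSubring → ∃ B ∈ 𝓑, B.toSubring ≤ W.toSubring) :
    Set.Finite {W : ValuationSubring K | ∃ hk : (∀ c : k, algebraMap k K c ∈ W), IsDiscreteValuationRing W ∧ (∃ B : Subalgebra k K, B.FG ∧ B.toSubring ≤ W.toSubring ∧ ∀ x : K, x ∈ W → ∃ b s : K, b ∈ B ∧ s ∈ B ∧ s ∉ W.nonunits ∧ x * s = b) ∧ (∃ h : R.toSubring ≤ W.toSubring, ¬ IsRegularLocalRing (Localization.AtPrime (Ideal.comap (Subring.inclusion h) (IsLocalRing.maximalIdeal W)))) ∧ ¬ (∃ (L : Subfield (IsLocalRing.ResidueField W)) (t : IsLocalRing.ResidueField W), (∀ c : k, IsLocalRing.residue W ⟨algebraMap k K c, hk c⟩ ∈ L) ∧ (∀ f : Polynomial L, f ≠ 0 → Polynomial.eval₂ L.subtype t f ≠ 0) ∧ (∀ x : IsLocalRing.ResidueField W, ∃ f g : Polynomial L, Polynomial.eval₂ L.subtype t g ≠ 0 ∧ x * Polynomial.eval₂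 L.subtype t g = Polynomial.eval₂ L.subtype t f))} := by
  have hfin := regularAtlas_badSet_finite k K R hR hfr (fun W => IsDiscreteValuationRing W) 𝓑
    h𝓑fin h𝓑 (fun W hQ _ hk hRW => hcov W hQ hk hRW)
  refine hfin.subset ?_
  intro W hWmem
  obtain ⟨hk, hdvrW, hftW, hsingW, hnrW⟩ := hWmem
  refine ⟨hdvrW, hk, hsingW, ?_⟩
  rintro ⟨A, hAfg, hAfr, h', hreg, hdim⟩
  exact hnrW (RuledResiduesRegularModelRuled.regularModelRuled_proof k K W hk hdvrW hftW A hAfg hAfr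
    h' hreg hdim)

/-- **A witness function field has no finite regular atlas** ("no regular proper model").  If
`(p, k, K, R)` witnesses `NonRuledDivisors` then for EVERY finite family `𝓑` of finitely generated
regular `k`-subalgebras of `K` with fraction field `K`, some member of the (infinite) witness set —
a discrete valuation ring `W ≠ K` of `K` containing `k` and `R` — contains NONE of the charts.  By
the valuative criterion of properness this says that `K/k` admits no regular proper model at all
(such a model would give an atlas covering every valuation ring containing `k`); in particular the
witness function field is not rational and not the function field of a smooth projective variety.
[folklore] -/
theorem nonRuledDivisors_noRegularAtlas {p : ℕ} {k K : Type} [Field k] [CharP k p] [Field K]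
    [Algebra k K] (R : Subalgebra k K) (hR : R.FG) (hfr : IsFractionRing R K)
    (hinf : Set.Infinite {W : ValuationSubring K | ∃ hk : (∀ c : k, algebraMap k K c ∈ W), IsDiscreteValuationRing W ∧ (∃ B : Subalgebra k K, B.FG ∧ B.toSubring ≤ W.toSubring ∧ ∀ x : K, x ∈ W → ∃ b s : K, b ∈ B ∧ s ∈ B ∧ s ∉ W.nonunits ∧ x * s = b) ∧ (∃ h : R.toSubring ≤ W.toSubring, ¬ IsRegularLocalRing (Localization.AtPrime (Ideal.comap (Subring.inclusion h) (IsLocalRing.maximalIdeal W)))) ∧ ¬ (∃ (L : Subfield (IsLocalRing.ResidueField W)) (t : IsLocalRing.ResidueField W), (∀ c : k, IsLocalRing.residue W ⟨algebraMap k K c, hk c⟩ ∈ L) ∧ (∀ f : Polynomial L, f ≠ 0 → Polynomial.eval₂ L.subtype t f ≠ 0) ∧ (∀ x : IsLocalRing.ResidueField W, ∃ f g : Polynomial L, Polynomial.eval₂ L.subtype t g ≠ 0 ∧ x * Polynomial.eval₂ L.subtype t g = Polynomial.eval₂ L.subtype t f))})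
    (𝓑 : Set (Subalgebra k K)) (h𝓑fin : 𝓑.Finite)
    (h𝓑 : ∀ B ∈ 𝓑, B.FG ∧ IsFractionRing B K ∧ IsRegularRing B) :
    ∃ W : ValuationSubring K, W ≠ ⊤ ∧ (∀ c : k, algebraMap k K c ∈ W) ∧
      IsDiscreteValuationRing W ∧ R.toSubring ≤ W.toSubring ∧
      ∀ B ∈ 𝓑, ¬ B.toSubring ≤ W.toSubring := by
  by_contra hno
  push Not at hno
  apply hinf
  refine nonRuledDivisors_witnessSet_finite_of_regularAtlas k K R hR hfr 𝓑 h𝓑fin h𝓑 ?_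
  intro W hdvr hk hRW
  have hW : W ≠ ⊤ := by
    rintro rfl
    exact nonRuledDivisorsNeg_not_dvr_of_forall_mem (⊤ : ValuationSubring K)
      (fun x => ValuationSubring.mem_top x) hdvr
  exact hno W hW hk hdvr hRW

end Summit.ResolutionOfSingularities.ResolutionOfSingularities.Theorems

end
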